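import Summits.BirchSwinnertonDyer.BirchSwinnertonDyer.Theorems.GenusKolyvaginAtTwoShaCorestrictionLocalTriviality
import Summits.BirchSwinnertonDyer.BirchSwinnertonDyer.Theorems.GenusKolyvaginAtTwoShaCardDvdPowAtTwoPosTDefectOneBitLawKernel
import Literature.NumberTheory.EllipticCurves.H1CorestrictionIndexTwoEqCores
import HarnessLib

/-!
# Route `GenusKolyvaginAtTwo` — `corBaseChange` maps `Ш(E_K/K)` into `Ш(E/ℚ)` for every quadratic `K/ℚ`, and the one-bit law
# (K₄/K₄⁺ consistency law of gk2-p4 g27) WITHOUT its corestriction binders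

Seat `bsd-line-gk2-p4` g28 (cell `bsd-f1-sign2`), WIDTH-5 attach on route `GenusKolyvaginAtTwo` rev 57.  Sequel of
`…ShaCorestrictionLocalTransport` / `…ShaCorestrictionLocalTriviality` (`coresH1_galH1Model_mem_sha`: corestriction maps `Ш(E_K/K)`
into `Ш(E/ℚ)` for any finite Galois `K/ℚ`) and of `Literature/…/H1CorestrictionIndexTwoEqCores` (`corH1 = coresH1` for index `2`).

* §1 ★ `corBaseChange_mem_sha` — for a QUADRATIC `K/ℚ` (`[K:ℚ] = 2`, `σ₀ ≠ 1`), ANY `W/ℚ` and `x ∈ Ш(E_K/K)`: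
  `corBaseChange K W σ₀ h2 hσ₀ x ∈ Ш(E/ℚ)` — UNCONDITIONAL.  This is VERBATIM the displayed binder `hcorE` (and, for `W.quadraticTwist d`,
  `hcorT`) of gk2-p4 g27's one-bit-law files `…ShaCardDvdPowAtTwoPosTDefectOneBitLaw{,Exact,Kernel}` (p767735 / p767964 / p768230) and the
  premise `corBaseChange … c ∈ W.sha` of the Cassels–Tate res/cor packages (`CasselsTateCanonicalPackageOfResCor`, crux 19804), and it closes
  the «NOT HERE (by design)» clause of `Literature/…/ShaCorestrictionIndexTwo.lean`.
* §2 the one-bit law BY NAME without `hcorE`/`hcorT` (same statements otherwise, namespace `…GenusExact.ShaCores`):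
  `natCard_shaPrimary_le_torsionBy_mul_natCard` (`#Ш(E/K)[2^∞] ≤ #Ш(E/K)[2]·#Ш(E/ℚ)[2^∞]` for a twin with `Ш(T/ℚ)[2^∞] = 0`),
  `natCard_shaPrimary_dvd_pow_succ_of_exponent` (`∣ 4^(M₀+1)`), `natCard_shaPrimary_dvd_pow_of_exponent_of_kramerClass_mem` (`∣ 4^(M₀)`),
  `natCard_primaryComponent_sha_baseChange_two_dvd_pow_succ_of_defect` (the cut's frame at ANY Tamagawa defect: `∣ 4^(m+1)`),
  and — still modulo the named fact `casselsTate_pairing_resCor` (Fisher 2003 Prop. 2.16), nothing else —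
  `natCard_shaPrimary_eq_torsionBy_mul_natCard_of_adjoint` (case A: `#X = #X[2]·#Y`), `eight_le_relIndex_of_adjoint_of_frame` (`A ≥ 8`),
  `natCard_shaPrimary_eq_natCard_shaPrimary_rat_of_adjoint_of_kramerClass_mem_of_frame` (one-block cells with a capitulating class — K₄/K₄⁺:
  **`#Ш(E/K)[2^∞] = #Ш(E/ℚ)[2^∞]`**).

THEOREMS ONLY; no definition, no named fact, no `sorry`.  BSD is NOT proved by this file; no item is closed by it.

References: [MilneADT2006] I.§6 Rem. 6.10; [Fisher2003] Prop. 2.16; [SerreGaloisCohomology1997] I.§2.4; [Kramer1981] Thm. 1, Prop. 7;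
[Kolyvagin1989Izv] Thm. B₂; [McCallumLMS1991] §5 Cor. 5.6.
-/

set_option autoImplicit false
set_option linter.dupNamespace false -- `Summit.<P>.<Sub>` repeats `BirchSwinnertonDyer` (D-0017)

noncomputable section

open scoped Classical

namespace Summit.BirchSwinnertonDyer.BirchSwinnertonDyer.Theorems.GenusExact.ShaCores

open WeierstrassCurve NumberField IsDedekindDomain Literature.NumberTheory.EllipticCurves
  Literature.NumberTheory.GaloisRepresentations
  Summit.BirchSwinnertonDyer.BirchSwinnertonDyer.Theorems.GenusExact.PlusDescent

/-! ## §1 ★ `corBaseChange` maps `Ш(E_K/K)` into `Ш(E/ℚ)` -/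

section Quadratic

variable (K : Type) [Field K] [NumberField K] (W : WeierstrassCurve ℚ) {σ₀ : K ≃ₐ[ℚ] K}

/-- ★ **`cor (Ш(E_K/K)) ⊆ Ш(E/ℚ)` for a quadratic field.**  For ANY Weierstrass curve `W/ℚ`, a quadratic number field `K` (`[K:ℚ] = 2`,
`σ₀ ≠ 1`) and `x ∈ Ш(E_K/K)`: the corestriction `corBaseChange K W σ₀ h2 hσ₀ x` (Serre I.§2.4 / Fisher 2003, the tree's index-`2` transfer
composed with the model map) lies in `Ш(E/ℚ)`.  Proof: `corH1 = coresH1` (`corH1_apply_eq_coresH1`) and `coresH1_galH1Model_mem_sha`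
(Clark–Sharif local triviality at every place of `ℚ`).  UNCONDITIONAL; VERBATIM the binder `hcorE`/`hcorT` of the one-bit-law files.
[cite: MilneADT2006, I.§6 Rem. 6.10] [cite: Fisher2003, Prop. 2.16 (proof)] [cite: SerreGaloisCohomology1997, I.§2.4] -/
theorem corBaseChange_mem_sha (h2 : Module.finrank ℚ K = 2) (hσ₀ : σ₀ ≠ 1) (x : (W.baseChange K).galH1)
    (hx : x ∈ (W.baseChange K).sha) : corBaseChange K W σ₀ h2 hσ₀ x ∈ W.sha := by
  haveI : Algebra.IsQuadraticExtension ℚ K := ⟨h2⟩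
  haveI : IsGalois ℚ K := inferInstance
  haveI : (galRange (K := ℚ) K).Normal := normal_galRange K h2 hσ₀
  haveI : Fintype (Field.absoluteGaloisGroup ℚ ⧸ galRange (K := ℚ) K) :=
    Subgroup.fintypeOfIndexNeZero (by rw [index_galRange K h2 hσ₀]; norm_num)
  unfold corBaseChange
  rw [AddMonoidHom.comp_apply, corH1_apply_eq_coresH1]
  exact coresH1_galH1Model_mem_sha K W x hx

/-- The `Ш`-valued form: `⟨cor x, _⟩ ∈ Ш(E/ℚ)` with `res (cor x) = x + σ_* x` (tree: `resBaseChange_corBaseChange`) and `cor (res a) = 2a`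
(`corBaseChange_shaRestriction`). [cite: SerreGaloisCohomology1997, I.§2.4 Prop. 9] -/
theorem exists_sha_coe_eq_corBaseChange (h2 : Module.finrank ℚ K = 2) (hσ₀ : σ₀ ≠ 1) (x : (W.baseChange K).sha) :
    ∃ a : W.sha, (a : W.galH1) = corBaseChange K W σ₀ h2 hσ₀ (x : (W.baseChange K).galH1) :=
  ⟨⟨_, corBaseChange_mem_sha K W h2 hσ₀ x x.2⟩, rfl⟩

end Quadratic

/-! ## §2 The one-bit law without corestriction binders -/

section OneBit

variable (W : WeierstrassCurve ℚ) (K : Type) [Field K] [NumberField K]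

/-- **`#Ш(E/K)[2^∞] ≤ #Ш(E/K)[2] · #Ш(E/ℚ)[2^∞]`** on a twin with `Ш(T/ℚ)[2^∞] = 0` — `OneBit.natCard_shaPrimary_le_torsionBy_mul_natCard`
with its binders `hcorT`, `hcorE` DISCHARGED by `corBaseChange_mem_sha`. [cite: Kramer1981, Thm. 1] [cite: GrossLMS1991, §5 (5.1)–(5.3)] -/
theorem natCard_shaPrimary_le_torsionBy_mul_natCard (hIQ : IsImaginaryQuadratic K) {σ : K ≃ₐ[ℚ] K} (hσ1 : σ ≠ 1)
    [Finite (AddCommGroup.primaryComponent (↥W.sha) 2)] [Finite (AddCommGroup.primaryComponent (↥(W.baseChange K).sha) 2)]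
    (hT0 : ∀ x ∈ AddCommGroup.primaryComponent (↥(W.quadraticTwist (NumberField.discr K : ℚ)).sha) 2, x = 0) :
    Nat.card (AddCommGroup.primaryComponent (↥(W.baseChange K).sha) 2) ≤
      Nat.card (AddSubgroup.torsionBy (↥(W.baseChange K).sha) ((2 : ℕ) : ℤ)) * Nat.card (AddCommGroup.primaryComponent (↥W.sha) 2) :=
  OneBit.natCard_shaPrimary_le_torsionBy_mul_natCard W K hIQ hσ1 hT0 (corBaseChange_mem_sha K _ hIQ.1 hσ1)
    (corBaseChange_mem_sha K W hIQ.1 hσ1)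

variable [W.IsElliptic]

/-- **`#Ш(E/K)[2^∞] ∣ 4^(M₀+1)` at ANY Tamagawa defect** — `OneBit.natCard_shaPrimary_dvd_pow_succ_of_exponent` without `hcorT`/`hcorE`.
[cite: Kolyvagin1989Izv, Thm. B₂] [cite: Kramer1981, Thm. 1] [cite: McCallumLMS1991, §5 Cor. 5.6] -/
theorem natCard_shaPrimary_dvd_pow_succ_of_exponent (hIQ : IsImaginaryQuadratic K) {σ : K ≃ₐ[ℚ] K} (hσ1 : σ ≠ 1)
    [Finite (AddCommGroup.primaryComponent (↥W.sha) 2)] [Finite (AddCommGroup.primaryComponent (↥(W.baseChange K).sha) 2)]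
    (hT0 : ∀ x ∈ AddCommGroup.primaryComponent (↥(W.quadraticTwist (NumberField.discr K : ℚ)).sha) 2, x = 0)
    {M₀ : ℕ} (hexp : ∀ a ∈ AddCommGroup.primaryComponent (↥W.sha) 2, 2 ^ M₀ • a = 0)
    (h4 : Nat.card (AddSubgroup.torsionBy (↥W.sha) ((2 : ℕ) : ℤ)) ≤ 4)
    (hX4 : Nat.card (AddSubgroup.torsionBy (↥(W.baseChange K).sha) ((2 : ℕ) : ℤ)) ≤ 4) :
    Nat.card (AddCommGroup.primaryComponent (↥(W.baseChange K).sha) 2) ∣ 2 ^ (2 * (M₀ + 1)) :=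
  OneBit.natCard_shaPrimary_dvd_pow_succ_of_exponent W K hIQ hσ1 hT0 (corBaseChange_mem_sha K _ hIQ.1 hσ1)
    (corBaseChange_mem_sha K W hIQ.1 hσ1) hexp h4 hX4

/-- **`#Ш(E/K)[2^∞] ∣ 4^(M₀)` when a non-zero `2`-primary class of `Ш(E/ℚ)` dies in `Ш(E/K)`** —
`OneBit.natCard_shaPrimary_dvd_pow_of_exponent_of_kramerClass_mem` without `hcorT`/`hcorE`.
[cite: Kolyvagin1989Izv, Thm. B₂] [cite: Kramer1981, Thm. 1, Prop. 7] [cite: McCallumLMS1991, §5 Cor. 5.6] -/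
theorem natCard_shaPrimary_dvd_pow_of_exponent_of_kramerClass_mem (hIQ : IsImaginaryQuadratic K) {σ : K ≃ₐ[ℚ] K} (hσ1 : σ ≠ 1)
    [Finite (AddCommGroup.primaryComponent (↥W.sha) 2)] [Finite (AddCommGroup.primaryComponent (↥(W.baseChange K).sha) 2)]
    (hT0 : ∀ x ∈ AddCommGroup.primaryComponent (↥(W.quadraticTwist (NumberField.discr K : ℚ)).sha) 2, x = 0)
    (hKr : ∃ η : W.galH1, η ∈ (AddCommGroup.primaryComponent (↥W.sha) 2).map W.sha.subtype ∧ η ≠ 0 ∧ resBaseChange W K η = 0)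
    {M₀ : ℕ} (hexp : ∀ a ∈ AddCommGroup.primaryComponent (↥W.sha) 2, 2 ^ M₀ • a = 0)
    (h4 : Nat.card (AddSubgroup.torsionBy (↥W.sha) ((2 : ℕ) : ℤ)) ≤ 4)
    (hX4 : Nat.card (AddSubgroup.torsionBy (↥(W.baseChange K).sha) ((2 : ℕ) : ℤ)) ≤ 4) :
    Nat.card (AddCommGroup.primaryComponent (↥(W.baseChange K).sha) 2) ∣ 2 ^ (2 * M₀) :=
  OneBit.natCard_shaPrimary_dvd_pow_of_exponent_of_kramerClass_mem W K hIQ hσ1 hT0 (corBaseChange_mem_sha K _ hIQ.1 hσ1)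
    (corBaseChange_mem_sha K W hIQ.1 hσ1) hKr hexp h4 hX4

/-- **THE UPPER HALF UP TO ONE BIT AT ANY TAMAGAWA DEFECT, on the cut's frame** —
`OneBit.natCard_primaryComponent_sha_baseChange_two_dvd_pow_succ_of_defect_of_cor` with the corestriction binders DISCHARGED: habitat `W`, cut
datum with `2^(M+1) ∤ P(1)`, `w(E) = +1`, `rank E(ℚ) = 0`, `#Sel₂(E) ∣ 4`, elliptic twin `Wd` with `#Sel₂(Wd) = 2`, `ord₂ C(Wd) = d`, the `ℚ`-side
exponent `m`, and ONE Kolyvagin–McCallum block over `K`: **`#Ш(E/K)[2^∞] ∣ 4^(m+1)`** for EVERY `d`.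
[cite: Kramer1981, Thm. 1, §2 Prop. 3] [cite: GrossLMS1991, §5 Prop. 5.3] [cite: Kolyvagin1989Izv, Thm. B₂] [cite: McCallumLMS1991, §5 Cor. 5.6] -/
theorem natCard_primaryComponent_sha_baseChange_two_dvd_pow_succ_of_defect [W.IsGloballyMinimal] [NeZero (W.conductorNorm ℤ)]
    (hT : Odd W.tamagawaProduct) (hIQ : IsImaginaryQuadratic K) (hodd : Odd (NumberField.discr K))
    (hHe : SatisfiesHeegnerHypothesis (W.conductorNorm ℤ) K) (hs2 : W.HasSurjectiveModNGaloisRep 2)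
    (Dt : Literature.NumberTheory.EllipticCurves.ModularForms.ModularParametrizationData W (W.conductorNorm ℤ)) (β : ℤ) (ι : K →+* ℂ)
    (d₁ : KolyvaginHeegnerData Dt β ι 1) (hy : ¬ IsOfFinAddOrder d₁.derivedPoint) (M : ℕ)
    (hndiv : ¬ ∃ Q : (W.baseChange (ringClassField K ι 1)).toAffine.Point, ((2 ^ (M + 1) : ℕ) : ℤ) • Q = d₁.derivedPoint)
    (hw : W.rootNumber = 1) (hrk0 : W.mordellWeilRank = 0) (hSel4 : Nat.card (W.selmerGroup 2) ∣ 4)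
    (Wd : WeierstrassCurve ℚ) [Wd.IsElliptic] (hWd : ∃ C : VariableChange ℚ, C • W.quadraticTwist (NumberField.discr K : ℚ) = Wd)
    (hSel : Nat.card (Wd.selmerGroup 2) = 2) {d : ℕ} (hDEF : padicValNat 2 Wd.tamagawaProduct = d)
    {m : ℕ} (hB2Q : ∀ (k : ℕ) (a : W.galH1), a ∈ W.sha → ((2 ^ k : ℕ) : ℤ) • a = 0 → ((2 ^ m : ℕ) : ℤ) • a = 0)
    (hX4 : Nat.card (AddSubgroup.torsionBy (↥(W.baseChange K).sha) ((2 : ℕ) : ℤ)) ≤ 4) :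
    Nat.card (AddCommGroup.primaryComponent (W.baseChange K).sha 2) ∣ 2 ^ (2 * (m + 1)) :=
  OneBit.natCard_primaryComponent_sha_baseChange_two_dvd_pow_succ_of_defect_of_cor W K hT hIQ hodd hHe hs2 Dt β ι d₁ hy M hndiv hw
    hrk0 hSel4 Wd hWd hSel hDEF hB2Q (fun _ hσ1 ↦ corBaseChange_mem_sha K _ hIQ.1 hσ1) (fun _ hσ1 ↦ corBaseChange_mem_sha K W hIQ.1 hσ1)
    hX4

/-- **THE ONE-BIT LAW IS EXACT IN CASE A: `#Ш(E/K)[2^∞] = #Ш(E/K)[2] · #Ш(E/ℚ)[2^∞]`**, modulo `hRC` = the named fact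
`casselsTate_pairing_resCor` (Fisher 2003 Prop. 2.16) ONLY — `OneBit.natCard_shaPrimary_eq_torsionBy_mul_natCard_of_adjoint` without
`hcorT`/`hcorE`. [cite: Fisher2003, Prop. 2.16] [cite: Kramer1981, Thm. 1, Thm. 2] [cite: MilneADT2006, I Thm. 6.13] -/
theorem natCard_shaPrimary_eq_torsionBy_mul_natCard_of_adjoint (hIQ : IsImaginaryQuadratic K) {σ : K ≃ₐ[ℚ] K} (hσ1 : σ ≠ 1)
    (hRC : casselsTate_pairing_resCor K σ hIQ.1 hσ1)
    [Finite (AddCommGroup.primaryComponent (↥W.sha) 2)] [Finite (AddCommGroup.primaryComponent (↥(W.baseChange K).sha) 2)]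
    (hT0 : ∀ x ∈ AddCommGroup.primaryComponent (↥(W.quadraticTwist (NumberField.discr K : ℚ)).sha) 2, x = 0)
    (hA : ∀ η : W.galH1, η ∈ (AddCommGroup.primaryComponent (↥W.sha) 2).map W.sha.subtype → resBaseChange W K η = 0 → η = 0) :
    Nat.card (AddCommGroup.primaryComponent (↥(W.baseChange K).sha) 2) =
      Nat.card (AddSubgroup.torsionBy (↥(W.baseChange K).sha) ((2 : ℕ) : ℤ)) * Nat.card (AddCommGroup.primaryComponent (↥W.sha) 2) :=
  OneBit.natCard_shaPrimary_eq_torsionBy_mul_natCard_of_adjoint W K hIQ hσ1 hRC hT0 (corBaseChange_mem_sha K _ hIQ.1 hσ1)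
    (corBaseChange_mem_sha K W hIQ.1 hσ1) hA

/-- **`A ≥ 8` on a one-block cell in case A**, modulo `hRC` only — `OneBit.eight_le_relIndex_of_adjoint_of_frame` without `hcorT`/`hcorE`:
the LINE-24 budget B⁼²_A «`A · A′ ≤ 4`» cannot hold on its own frame. [cite: Kramer1981, Thm. 1, Thm. 2] [cite: Fisher2003, Prop. 2.16] -/
theorem eight_le_relIndex_of_adjoint_of_frame (hIQ : IsImaginaryQuadratic K) {σ : K ≃ₐ[ℚ] K} (hσ1 : σ ≠ 1)
    (hRC : casselsTate_pairing_resCor K σ hIQ.1 hσ1)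
    (h2tors : ∀ P : (W.baseChange K).toAffine.Point, (2 : ℤ) • P = 0 → P = 0)
    (hrk : (W.baseChange K).mordellWeilRank ≤ 1)
    (y : (W.baseChange K).toAffine.Point) (M : ℕ)
    (hndiv : ∀ Q : (W.baseChange K).toAffine.Point, ((2 ^ (M + 1) : ℕ) : ℤ) • Q ≠ y)
    (hanti : IsOfFinAddOrder (Affine.Point.map (W' := W) (σ : K →ₐ[ℚ] K) y + y))
    [Finite (AddCommGroup.primaryComponent (↥W.sha) 2)] [Finite (AddCommGroup.primaryComponent (↥(W.baseChange K).sha) 2)]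
    (hne : (W.sha).relIndex (((W.baseChange K).sha).comap (resBaseChange W K)) ≠ 0)
    (hT0 : ∀ x ∈ AddCommGroup.primaryComponent (↥(W.quadraticTwist (NumberField.discr K : ℚ)).sha) 2, x = 0)
    (hA : ∀ η : W.galH1, η ∈ (AddCommGroup.primaryComponent (↥W.sha) 2).map W.sha.subtype → resBaseChange W K η = 0 → η = 0)
    (hX4 : Nat.card (AddSubgroup.torsionBy (↥(W.baseChange K).sha) ((2 : ℕ) : ℤ)) = 4) :
    8 ≤ (W.sha).relIndex (((W.baseChange K).sha).comap (resBaseChange W K)) :=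
  OneBit.eight_le_relIndex_of_adjoint_of_frame W K hIQ hσ1 hRC h2tors hrk y M hndiv hanti hne hT0
    (corBaseChange_mem_sha K _ hIQ.1 hσ1) (corBaseChange_mem_sha K W hIQ.1 hσ1) hA hX4

/-- ★ **THE K₄/K₄⁺ CONSISTENCY LAW: `#Ш(E/K)[2^∞] = #Ш(E/ℚ)[2^∞]`** on a one-block cell of the frame (`#Ш(E/K)[2] = 4`) where some non-zero
`2`-primary class of `Ш(E/ℚ)` dies in `Ш(E/K)` (the capitulating class — gk2-p5's `s_y` on K₄⁺, the LEAD's port on K₄), modulo `hRC` ONLY —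
`OneBit.natCard_shaPrimary_eq_natCard_shaPrimary_rat_of_adjoint_of_kramerClass_mem_of_frame` without `hcorT`/`hcorE`.  Reading: on these cells
Kolyvagin's `K`-side exactness `#Ш(E/K)[2^∞] = 4^(M₀)` transfers to `ℚ` LOSSLESSLY (B₂ over `ℚ` is exact there).
[cite: Fisher2003, Prop. 2.16] [cite: Kramer1981, Thm. 1, Prop. 7, Thm. 2] [cite: SilvermanAEC2009, Thm. X.4.14] -/
theorem natCard_shaPrimary_eq_natCard_shaPrimary_rat_of_adjoint_of_kramerClass_mem_of_frame (hIQ : IsImaginaryQuadratic K)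
    {σ : K ≃ₐ[ℚ] K} (hσ1 : σ ≠ 1) (hRC : casselsTate_pairing_resCor K σ hIQ.1 hσ1)
    (h2tors : ∀ P : (W.baseChange K).toAffine.Point, (2 : ℤ) • P = 0 → P = 0)
    (hrk : (W.baseChange K).mordellWeilRank ≤ 1)
    (y : (W.baseChange K).toAffine.Point) (M : ℕ)
    (hndiv : ∀ Q : (W.baseChange K).toAffine.Point, ((2 ^ (M + 1) : ℕ) : ℤ) • Q ≠ y)
    (hanti : IsOfFinAddOrder (Affine.Point.map (W' := W) (σ : K →ₐ[ℚ] K) y + y))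
    [Finite (AddCommGroup.primaryComponent (↥W.sha) 2)] [Finite (AddCommGroup.primaryComponent (↥(W.baseChange K).sha) 2)]
    (hT0 : ∀ x ∈ AddCommGroup.primaryComponent (↥(W.quadraticTwist (NumberField.discr K : ℚ)).sha) 2, x = 0)
    (hKr : ∃ η : W.galH1, η ∈ (AddCommGroup.primaryComponent (↥W.sha) 2).map W.sha.subtype ∧ η ≠ 0 ∧ resBaseChange W K η = 0)
    (hX4 : Nat.card (AddSubgroup.torsionBy (↥(W.baseChange K).sha) ((2 : ℕ) : ℤ)) = 4) :
    Nat.card (AddCommGroup.primaryComponent (↥(W.baseChange K).sha) 2) = Nat.card (AddCommGroup.primaryComponent (↥W.sha) 2) :=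
  OneBit.natCard_shaPrimary_eq_natCard_shaPrimary_rat_of_adjoint_of_kramerClass_mem_of_frame W K hIQ hσ1 hRC h2tors hrk y M hndiv
    hanti hT0 (corBaseChange_mem_sha K _ hIQ.1 hσ1) (corBaseChange_mem_sha K W hIQ.1 hσ1) hKr hX4

end OneBit

end Summit.BirchSwinnertonDyer.BirchSwinnertonDyer.Theorems.GenusExact.ShaCores

end
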